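import Summits.CriticalPhenomena.PercolationContinuityZ3.Theorems.Transplant.GrigorchukSectionsDefs
import Summits.CriticalPhenomena.PercolationContinuityZ3.Theorems.Transplant.GrigorchukNormalForms
import Mathlib.GroupTheory.OrderOfElement
import Mathlib.Tactic.Group
import HarnessLib

/-!
# GRIGORCHUK'S TORSION THEOREM for the tree's first Grigorchuk group: every element of `𝔊 = ⟨a, b, c, d⟩ ≤ Perm({0,1}^ℕ)` has finite order

builds on p205010 (kernel theorem, internal audit signed; external expert review pending) — nothing in this file uses p205010; pure group theory, no percolation
statement, no node touched.  Group theory of `𝔊` (Grigorchuk 1980): file F3 of the O7 plan (`run/shared/lean/prim/bschramm/P3-NILPOTENT.md` §28.6; lead g25 rulings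
2026-08-28 00:30Z/00:37Z), used only to discharge the binder `htor` of «GrigorchukLamplighterStandardGensNoGo» p589680 (customer file «GrigorchukLamplighterStandardGens
NoGoHolds»).  PROOF LANE, def-free but for the section words `sw`/`psw` (two small `def`s on letters — definition lane if the gate says so).  Lane `prim-bschramm`, seat
`prim-bschramm-p3` gen 35 (DESIGN OWNER).  Helper file (`--supports stmt-CriticalPhenomena-4575 --as helper`).  NOTHING about growth or amenability; nothing about
the end state.

THE PROOF (Grigorchuk 1980; de la Harpe 2000, Thm VIII.17 — re-cut for the kernel on the alternating normal forms of «GrigorchukNormalForms» and the sections of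
«GrigorchukSectionsDefs»; no free group, no automata).  By induction on the pair (len, weight) of a normal form `N = [a]^p (x₁ a)⋯(x_k a) q`:
* §1 finite order is inherited from conjugates, from the square, and — for `g ∈ St(1)` — from the two sections (`ψ` injective homomorphism).
* §2 the SECTION WORDS: `sw s x` = the section of the Klein letter `x` at `s` (`(b)₀ = a, (b)₁ = c, (c)₀ = a, (c)₁ = d, (d)₀ = 1, (d)₁ = b`) as a word of ≤ 1 letter, and
  `psw s L` = the alternating concatenation; for `|L|` even, `blocks L = Π (xᵢ a) ∈ St(1)` and its sections are the products of `psw s L` (`sec_blocks`); the two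
  COUNTS `|psw s L| + |psw ¬s L| = 2|L| − #d(L)` and `wwt(psw s L) + wwt(psw ¬s L) = Σ wt((xᵢ)₁)`.
* §3 THE INDUCTION.  Main shape `blocks L`, `|L| = k`: `k` even ⇒ sections are words of `≤ k < 2k` letters; `k` odd ⇒ `(blocks L)² = blocks (L ++ L)` has sections
  `psw s L ++ psw ¬s L`, of length `2k − #d(L) < 2k` if `d ∈ L`, else of length `≤ 2k` and weight `Σ (wt xᵢ − 1) < weight` — the letters SHIFT `b ↦ c ↦ d`; the other
  three shapes are conjugate (by `a` or by `q`) to a main shape of the same (len, weight) or to a form of smaller len.  **`Grigorchuk.isOfFinOrder_of_mem`.**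
[cite: Grigorchuk1980, Theorem: every element of the group has finite order (a 2-group)] [cite: BartholdiErschler2012, §3.1 (the first Grigorchuk group is an
infinite torsion group — citing Grigorchuk)]
-/

noncomputable section

namespace Summit.CriticalPhenomena.PercolationContinuityZ3.Theorems.Transplant

namespace Grigorchuk

/-! ## §1 Finite order: conjugates, squares, sections -/

/-- `a² = 1` (local copy, keeping imports light). [cite: Grigorchuk1980, a is an involution] -/
private theorem genA_sq' : genA * genA = 1 := Equiv.ext fun x => flipAt_involutive 0 x

/-- Finite order passes to conjugates. [folklore] -/
theorem isOfFinOrder_of_conj {g h : Equiv.Perm Ray} (hg : IsOfFinOrder g) : IsOfFinOrder (h * g * h⁻¹) := by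
  obtain ⟨n, hn, hgn⟩ := hg.exists_pow_eq_one
  exact isOfFinOrder_iff_pow_eq_one.2 ⟨n, hn, by rw [conj_pow, hgn, mul_one, mul_inv_cancel]⟩

/-- Finite order of `g²` gives finite order of `g`. [folklore] -/
theorem isOfFinOrder_of_sq {g : Equiv.Perm Ray} (hg : IsOfFinOrder (g * g)) : IsOfFinOrder g := by
  obtain ⟨n, hn, hgn⟩ := hg.exists_pow_eq_one
  exact isOfFinOrder_iff_pow_eq_one.2 ⟨2 * n, by omega, by rw [pow_mul, pow_two, hgn]⟩

/-- **For `g ∈ St(1)`: if both sections have finite order, so does `g`** (`ψ` is an injective homomorphism). [cite: BartholdiErschler2012, §3.1 (ψ injective)] -/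
theorem isOfFinOrder_of_sec (g : ↥stabOne) (h0 : IsOfFinOrder (sec false g)) (h1 : IsOfFinOrder (sec true g)) :
    IsOfFinOrder (g : Equiv.Perm Ray) := by
  obtain ⟨m, hm, hgm⟩ := h0.exists_pow_eq_one
  obtain ⟨n, hn, hgn⟩ := h1.exists_pow_eq_one
  have hpow : g ^ (m * n) = 1 := by
    refine eq_of_sec_eq ?_ ?_
    · rw [map_pow, map_one, pow_mul, hgm, one_pow]
    · rw [map_pow, map_one, mul_comm, pow_mul, hgn, one_pow]
  refine isOfFinOrder_iff_pow_eq_one.2 ⟨m * n, Nat.mul_pos hm hn, ?_⟩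
  rw [← Subgroup.coe_pow, hpow, Subgroup.coe_one]

/-! ## §2 Section words -/

/-- The section of a Klein letter at `s`, as a word of at most one letter: `(b)₀ = a`, `(c)₀ = a`, `(d)₀ = 1`; `(b)₁ = c`, `(c)₁ = d`, `(d)₁ = b`.
[cite: Grigorchuk1980, relations b = (a, c), c = (a, d), d = (1, b)] -/
def sw : Bool → BCD → List Letter
  | false, .b => [.a]
  | false, .c => [.a]
  | false, .d => []
  | true, .b => [.x .c]
  | true, .c => [.x .d]
  | true, .d => [.x .b]

/-- The alternating section word of a list of Klein letters: `psw s (x :: L) = sw s x ++ psw ¬s L`. [cite: Grigorchuk1980, sections of a word] -/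
def psw : Bool → List BCD → List Letter
  | _, [] => []
  | s, x :: L => sw s x ++ psw (!s) L

/-- `psw s [] = []`. [folklore] -/
@[simp] theorem psw_nil (s : Bool) : psw s [] = [] := by cases s <;> rfl

/-- `psw s (x :: L) = sw s x ++ psw ¬s L`. [folklore] -/
@[simp] theorem psw_cons (s : Bool) (x : BCD) (L : List BCD) : psw s (x :: L) = sw s x ++ psw (!s) L := by cases s <;> rfl

/-- `psw` over a concatenation: the parity flips with the length of the first part. [folklore] -/
theorem psw_append (s : Bool) (L M : List BCD) : psw s (L ++ M) = psw s L ++ psw (xor s (decide (L.length % 2 = 1))) M := by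
  induction L generalizing s with
  | nil => cases s <;> simp
  | cons x L ih =>
    rw [List.cons_append, psw_cons, psw_cons, ih, List.append_assoc, List.length_cons]
    congr 2
    have h2 : (L.length + 1) % 2 = 1 ↔ ¬ (L.length % 2 = 1) := by omega
    cases s <;> by_cases h : L.length % 2 = 1 <;> simp [h, h2]

/-- The product of a word. [folklore] -/
theorem prod_append_letters (w w' : List Letter) :
    ((w ++ w').map Letter.toPerm).prod = (w.map Letter.toPerm).prod * (w'.map Letter.toPerm).prod := by
  rw [List.map_append, List.prod_append]

/-- A Klein letter lies in `St(1)`. [cite: BartholdiErschler2012, §3.1] -/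
theorem BCD.toPerm_mem_stabOne (x : BCD) : x.toPerm ∈ stabOne := by
  cases x
  · exact genB_mem_stabOne
  · exact genC_mem_stabOne
  · exact genD_mem_stabOne

/-- **The section of a Klein letter is its section word.** [cite: Grigorchuk1980, relations b = (a, c), c = (a, d), d = (1, b)] -/
theorem sec_letter (s : Bool) (x : BCD) (h : x.toPerm ∈ stabOne) : (sec s ⟨x.toPerm, h⟩ : Equiv.Perm Ray) = ((sw s x).map Letter.toPerm).prod := by
  cases x <;> cases s
  · exact sec_bSt.1.trans (by simp [sw, Letter.toPerm])
  · exact sec_bSt.2.trans (by simp [sw, Letter.toPerm, BCD.toPerm, BCD.toV4, V4.toPerm])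
  · exact sec_cSt.1.trans (by simp [sw, Letter.toPerm])
  · exact sec_cSt.2.trans (by simp [sw, Letter.toPerm, BCD.toPerm, BCD.toV4, V4.toPerm])
  · exact sec_dSt.1.trans (by simp [sw])
  · exact sec_dSt.2.trans (by simp [sw, Letter.toPerm, BCD.toPerm, BCD.toV4, V4.toPerm])

/-- **A pair of blocks `x a x′ a = x · (a x′ a)` lies in `St(1)` with sections `(x)ₛ (x′)_{¬s}`.** [cite: Grigorchuk1980, sections of a word] -/
theorem sec_pair (s : Bool) (x x' : BCD) (h : x.toPerm * genA * (x'.toPerm * genA) ∈ stabOne) :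
    (sec s ⟨x.toPerm * genA * (x'.toPerm * genA), h⟩ : Equiv.Perm Ray) = ((sw s x ++ sw (!s) x').map Letter.toPerm).prod := by
  have hx := BCD.toPerm_mem_stabOne x
  have hc : genA * x'.toPerm * genA ∈ stabOne := conj_genA_mem_stabOne (BCD.toPerm_mem_stabOne x')
  have e : (⟨x.toPerm * genA * (x'.toPerm * genA), h⟩ : ↥stabOne) = ⟨x.toPerm, hx⟩ * ⟨genA * x'.toPerm * genA, hc⟩ :=
    Subtype.ext (by simp only [Subgroup.coe_mul]; group)
  rw [e, map_mul, prod_append_letters, ← sec_letter s x hx, ← sec_letter (!s) x' (BCD.toPerm_mem_stabOne x')]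
  congr 1
  exact sec_conj_genA ⟨x'.toPerm, BCD.toPerm_mem_stabOne x'⟩ s

/-- A pair of blocks lies in `St(1)`. [cite: BartholdiErschler2012, §3.1] -/
theorem pair_mem_stabOne (x x' : BCD) : x.toPerm * genA * (x'.toPerm * genA) ∈ stabOne := by
  have e : x.toPerm * genA * (x'.toPerm * genA) = x.toPerm * (genA * x'.toPerm * genA) := by group
  rw [e]; exact stabOne.mul_mem (BCD.toPerm_mem_stabOne x) (conj_genA_mem_stabOne (BCD.toPerm_mem_stabOne x'))

/-- **An even number of blocks lies in `St(1)`.** [cite: BartholdiErschler2012, §3.1 (St(1) = words with an even number of a)] -/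
theorem blocks_mem_stabOne : ∀ (k : ℕ) (L : List BCD), L.length = 2 * k → blocks L ∈ stabOne := by
  intro k
  induction k with
  | zero => intro L hL; rw [List.length_eq_zero_iff.1 (by omega : L.length = 0)]; exact stabOne.one_mem
  | succ k ih =>
    intro L hL
    match L, hL with
    | x :: x' :: M, hM =>
      rw [blocks_cons, blocks_cons, ← mul_assoc]
      exact stabOne.mul_mem (pair_mem_stabOne x x') (ih M (by simp at hM; omega))

/-- **The sections of an even number of blocks are the section words** `psw s L`. [cite: Grigorchuk1980, sections of a word] -/
theorem sec_blocks : ∀ (k : ℕ) (L : List BCD) (hL : L.length = 2 * k) (h : blocks L ∈ stabOne) (s : Bool),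
    (sec s ⟨blocks L, h⟩ : Equiv.Perm Ray) = ((psw s L).map Letter.toPerm).prod := by
  intro k
  induction k with
  | zero =>
    intro L hL h s
    have hL0 : L = [] := List.length_eq_zero_iff.1 (by omega)
    subst hL0
    rw [show (⟨blocks [], h⟩ : ↥stabOne) = 1 from Subtype.ext blocks_nil, map_one]; simp
  | succ k ih =>
    intro L hL h s
    match L, hL, h with
    | x :: x' :: M, hM, hxM =>
      have hMlen : M.length = 2 * k := by simp at hM; omega
      have hMmem : blocks M ∈ stabOne := blocks_mem_stabOne k M hMlen
      have e : (⟨blocks (x :: x' :: M), hxM⟩ : ↥stabOne) =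
          ⟨x.toPerm * genA * (x'.toPerm * genA), pair_mem_stabOne x x'⟩ * ⟨blocks M, hMmem⟩ :=
        Subtype.ext (by simp only [Subgroup.coe_mul, blocks_cons]; group)
      rw [e, map_mul, sec_pair, ih M hMlen hMmem, psw_cons, psw_cons, Bool.not_not, ← List.append_assoc,
        prod_append_letters, prod_append_letters, prod_append_letters]

/-- The number of `d`'s in a list. [folklore] -/
theorem length_sw_add (s : Bool) (x : BCD) : (sw s x).length + (sw (!s) x).length = 2 - (if x = .d then 1 else 0) := by
  cases s <;> cases x <;> rfl

/-- **`|psw s L| + |psw ¬s L| = 2|L| − #d(L)`.** [cite: Grigorchuk1980, length reduction] -/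
theorem length_psw_add (L : List BCD) : ∀ s : Bool, (psw s L).length + (psw (!s) L).length + L.count .d = 2 * L.length := by
  induction L with
  | nil => intro s; cases s <;> simp
  | cons x L ih =>
    intro s
    rw [psw_cons, psw_cons, Bool.not_not, List.length_append, List.length_append, List.count_cons, List.length_cons]
    have h1 := length_sw_add s x
    have h2 := ih (!s)
    rw [Bool.not_not] at h2
    by_cases hx : x = .d <;> simp [hx] at h1 ⊢ <;> omega

/-- `|psw s L| ≤ |L|`. [folklore] -/
theorem length_psw_le (L : List BCD) : ∀ s : Bool, (psw s L).length ≤ L.length := by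
  induction L with
  | nil => intro s; simp
  | cons x L ih =>
    intro s
    rw [psw_cons, List.length_append, List.length_cons]
    have h1 : (sw s x).length ≤ 1 := by cases s <;> cases x <;> decide
    have := ih (!s)
    omega

/-- **`wwt(psw s L) + wwt(psw ¬s L) = Σ wt((xᵢ)₁)` and `wt((x)₁) + 1 = wt(x)` unless `x = d`.** Stated as the inequality used:
`wwt(psw s L) + wwt(psw ¬s L) + #{non-d letters} ≤ weight` — precisely `… + |L| ≤ Σ wt(xᵢ) + 3·#d(L)`. [folklore] -/
theorem wordWeight_psw_add (L : List BCD) : ∀ s : Bool,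
    wordWeight (psw s L) + wordWeight (psw (!s) L) + L.length ≤ (L.map fun x => x.toV4.wt).sum + 3 * L.count .d := by
  induction L with
  | nil => intro s; cases s <;> simp [wordWeight]
  | cons x L ih =>
    intro s
    have h2 := ih (!s)
    rw [Bool.not_not] at h2
    have h1 : wordWeight (sw s x) + wordWeight (sw (!s) x) + 1 ≤ x.toV4.wt + 3 * (if x = .d then 1 else 0) := by
      cases s <;> cases x <;> decide
    have hw : ∀ u v : List Letter, wordWeight (u ++ v) = wordWeight u + wordWeight v := fun u v => by
      simp [wordWeight, List.map_append, List.sum_append]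
    rw [psw_cons, psw_cons, Bool.not_not, hw, hw, List.count_cons, List.length_cons, List.map_cons, List.sum_cons]
    by_cases hx : x = .d <;> simp [hx] at h1 ⊢ <;> omega

/-! ## §3 The induction -/

/-- A non-empty list is a shorter list followed by its last element. [folklore] -/
theorem exists_eq_append_singleton {α : Type} (L : List α) (h : L ≠ []) : ∃ (M : List α) (x : α), L = M ++ [x] :=
  ⟨L.dropLast, L.getLast h, (List.dropLast_append_getLast h).symm⟩

/-- The main shape as a normal form. [folklore] -/
theorem eval_main (L : List BCD) : (⟨false, L, .e⟩ : NForm).eval = blocks L := by simp [NForm.eval]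

/-- **MAIN STEP.**  If every normal form of smaller length, and every normal form of the same length and smaller weight, has finite order, then `blocks L` has
finite order (`len = 2|L|`, `weight = Σ wt xᵢ`). [cite: Grigorchuk1980, proof of the torsion theorem] -/
theorem main_step (n w : ℕ) (ihn : ∀ N : NForm, N.len < n → IsOfFinOrder N.eval)
    (ihw : ∀ N : NForm, N.len ≤ n → N.weight < w → IsOfFinOrder N.eval)
    (L : List BCD) (hn : 2 * L.length ≤ n) (hw : (L.map fun x => x.toV4.wt).sum ≤ w) : IsOfFinOrder (blocks L) := by
  rcases Nat.even_or_odd L.length with ⟨k, hk⟩ | ⟨k, hk⟩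
  · -- `|L| = 2k`: `blocks L ∈ St(1)` with sections the words `psw s L` of length `≤ |L| < 2|L|` (if `L ≠ []`)
    have hL : L.length = 2 * k := by omega
    have hmem := blocks_mem_stabOne k L hL
    by_cases h0 : L.length = 0
    · rw [List.length_eq_zero_iff.1 h0, blocks_nil]; exact IsOfFinOrder.one
    refine isOfFinOrder_of_sec ⟨blocks L, hmem⟩ ?_ ?_
    · rw [sec_blocks k L hL hmem, ← eval_nf]
      exact ihn _ (lt_of_le_of_lt (len_nf_le _) (by have := length_psw_le L false; omega))
    · rw [sec_blocks k L hL hmem, ← eval_nf]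
      exact ihn _ (lt_of_le_of_lt (len_nf_le _) (by have := length_psw_le L true; omega))
  · -- `|L| = 2k+1`: square
    have hL : L.length = 2 * k + 1 := hk
    have hmem : blocks (L ++ L) ∈ stabOne := blocks_mem_stabOne (2 * k + 1) (L ++ L) (by rw [List.length_append]; omega)
    refine isOfFinOrder_of_sq ?_
    rw [← blocks_append]
    -- the sections of the square are `psw s L ++ psw ¬s L`
    have hsec : ∀ s : Bool, (sec s ⟨blocks (L ++ L), hmem⟩ : Equiv.Perm Ray) = ((psw s L ++ psw (!s) L).map Letter.toPerm).prod := by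
      intro s
      rw [sec_blocks (2 * k + 1) (L ++ L) (by rw [List.length_append]; omega) hmem, psw_append]
      congr 3
      rw [hL]; cases s <;> simp
    have hcount := length_psw_add L
    have hww := wordWeight_psw_add L
    have hw2 : ∀ u v : List Letter, wordWeight (u ++ v) = wordWeight u + wordWeight v := fun u v => by
      simp [wordWeight, List.map_append, List.sum_append]
    have hc0 := hcount false
    have hc1 := hcount true
    have hw0 := hww false
    have hw1 := hww true
    simp only [Bool.not_false, Bool.not_true] at hc0 hc1 hw0 hw1
    have hpos : 0 < L.length := by omega
    refine isOfFinOrder_of_sec ⟨blocks (L ++ L), hmem⟩ ?_ ?_ <;> rw [hsec, ← eval_nf] <;>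
      simp only [Bool.not_false, Bool.not_true]
    all_goals
      by_cases hd : 0 < L.count BCD.d
      · -- a `d` drops the length
        refine ihn _ (lt_of_le_of_lt (len_nf_le _) ?_)
        rw [List.length_append]; omega
      · -- no `d`: same length, smaller weight (every letter shifts `b ↦ c ↦ d`)
        have hd0 : L.count BCD.d = 0 := by omega
        refine ihw _ ((len_nf_le _).trans ?_) (lt_of_le_of_lt (weight_nf_le _) ?_)
        · rw [List.length_append]; omega
        · rw [hw2]; omega

/-- **THE INDUCTION**: every normal form of length `≤ n` and weight `≤ w` has finite order. [cite: Grigorchuk1980, proof of the torsion theorem] -/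
theorem isOfFinOrder_eval : ∀ (n w : ℕ) (N : NForm), N.len ≤ n → N.weight ≤ w → IsOfFinOrder N.eval := by
  intro n
  induction n using Nat.strong_induction_on with
  | _ n ihn =>
    intro w
    induction w using Nat.strong_induction_on with
    | _ w ihw =>
      intro N hn hw
      have IHn : ∀ N' : NForm, N'.len < n → IsOfFinOrder N'.eval := fun N' h => ihn N'.len h N'.weight N' le_rfl le_rfl
      have IHw : ∀ N' : NForm, N'.len ≤ n → N'.weight < w → IsOfFinOrder N'.eval := fun N' h h' => ihw N'.weight h' N' h le_rfl
      rcases N with ⟨p, L, q⟩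
      have hlen : (⟨p, L, q⟩ : NForm).len = (if p then 1 else 0) + 2 * L.length + (if q = .e then 0 else 1) := rfl
      have hwt : (⟨p, L, q⟩ : NForm).weight = (L.map fun x => x.toV4.wt).sum + q.wt := rfl
      -- the Klein letter `q` as a `BCD` letter when `q ≠ e`
      have hq : q = .e ∨ ∃ y : BCD, y.toV4 = q := by
        rcases q with _ | _ | _ | _
        · exact Or.inl rfl
        · exact Or.inr ⟨.b, rfl⟩
        · exact Or.inr ⟨.c, rfl⟩
        · exact Or.inr ⟨.d, rfl⟩
      rcases hq with rfl | ⟨y, rfl⟩ <;> cases p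
      · -- MAIN SHAPE `blocks L`
        rw [eval_main]
        exact main_step n w IHn IHw L (by simp [hlen] at hn; omega) (by simpa [hwt, V4.wt] using hw)
      · -- `a · blocks L`: conjugate by `a` to `blocks M · x` of smaller length (or `a` itself)
        by_cases hL0 : L = []
        · -- `eval = a`
          subst hL0
          have : (⟨true, [], V4.e⟩ : NForm).eval = genA := by simp [NForm.eval]
          rw [this]; exact isOfFinOrder_iff_pow_eq_one.2 ⟨2, by omega, by rw [pow_two, genA_sq']⟩
        · obtain ⟨M, x, rfl⟩ := exists_eq_append_singleton L hL0
          have e : (⟨true, M ++ [x], V4.e⟩ : NForm).eval = genA * (⟨false, M, x.toV4⟩ : NForm).eval * genA⁻¹ := by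
            rw [show genA⁻¹ = genA from inv_eq_of_mul_eq_one_right genA_sq']
            simp only [NForm.eval, if_true, Bool.false_eq_true, if_false, one_mul, V4.toPerm_e, mul_one, blocks_append, blocks_cons,
              blocks_nil, BCD.toPerm]
            group
          rw [e]
          refine isOfFinOrder_of_conj (IHn _ ?_)
          have h1 : (⟨false, M, x.toV4⟩ : NForm).len = 2 * M.length + 1 := by cases x <;> simp [NForm.len, BCD.toV4]
          have h2 : (⟨true, M ++ [x], V4.e⟩ : NForm).len = 2 * M.length + 3 := by
            simp [NForm.len, List.length_append]; omega
          rw [h1]; rw [h2] at hn; omega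
      · -- `blocks L · y`: conjugate by `y` to `y · blocks L`, which merges into a shorter form
        rcases L with _ | ⟨x₁, L'⟩
        · -- `eval = y`, an involution
          have : (⟨false, [], y.toV4⟩ : NForm).eval = y.toPerm := by simp [NForm.eval, BCD.toPerm]
          rw [this]
          refine isOfFinOrder_iff_pow_eq_one.2 ⟨2, by omega, ?_⟩
          rw [pow_two, BCD.toPerm, ← V4.toPerm_mul]; cases y <;> rfl
        · have e : (⟨false, x₁ :: L', y.toV4⟩ : NForm).eval =
              y.toPerm⁻¹ * ((V4.mul y.toV4 x₁.toV4).toPerm * genA * blocks L') * y.toPerm⁻¹⁻¹ := by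
            rw [inv_inv, V4.toPerm_mul, ← BCD.toPerm]
            simp only [NForm.eval, Bool.false_eq_true, if_false, one_mul, blocks_cons, BCD.toPerm]
            rw [show (y.toV4.toPerm)⁻¹ = y.toV4.toPerm from inv_eq_of_mul_eq_one_right (by rw [← V4.toPerm_mul]; cases y <;> rfl)]
            have hy2 : y.toV4.toPerm * y.toV4.toPerm = 1 := by rw [← V4.toPerm_mul]; cases y <;> rfl
            calc x₁.toV4.toPerm * genA * blocks L' * y.toV4.toPerm
                = (y.toV4.toPerm * y.toV4.toPerm) * (x₁.toV4.toPerm * genA * blocks L' * y.toV4.toPerm) := by rw [hy2, one_mul]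
              _ = _ := by group
          rw [e]
          refine isOfFinOrder_of_conj ?_
          have hn' : 2 * L'.length + 3 ≤ n := by cases y <;> simp [NForm.len, BCD.toV4] at hn <;> omega
          -- the merged form: `(y x₁) a blocks L'` is `blocks (z :: L')` or, if `y x₁ = 1`, `a · blocks L'`
          rcases hm : V4.mul y.toV4 x₁.toV4 with _ | _ | _ | _
          · have : (V4.e.toPerm * genA * blocks L') = (⟨true, L', V4.e⟩ : NForm).eval := by simp [NForm.eval]
            rw [this]; refine IHn _ ?_; simp [NForm.len]; omega
          · have : (V4.b.toPerm * genA * blocks L') = blocks (.b :: L') := by simp [blocks_cons, BCD.toPerm, BCD.toV4]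
            rw [this, ← eval_main]; refine IHn _ ?_; simp [NForm.len]; omega
          · have : (V4.c.toPerm * genA * blocks L') = blocks (.c :: L') := by simp [blocks_cons, BCD.toPerm, BCD.toV4]
            rw [this, ← eval_main]; refine IHn _ ?_; simp [NForm.len]; omega
          · have : (V4.d.toPerm * genA * blocks L') = blocks (.d :: L') := by simp [blocks_cons, BCD.toPerm, BCD.toV4]
            rw [this, ← eval_main]; refine IHn _ ?_; simp [NForm.len]; omega
      · -- `a · blocks L · y`: conjugate by `a` to the main shape `blocks (L ++ [y])` of the same length and weight
        have e : (⟨true, L, y.toV4⟩ : NForm).eval = genA * blocks (L ++ [y]) * genA⁻¹ := by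
          rw [show genA⁻¹ = genA from inv_eq_of_mul_eq_one_right genA_sq']
          simp only [NForm.eval, if_true, blocks_append, blocks_cons, blocks_nil, mul_one, BCD.toPerm]
          rw [show genA * (blocks L * (y.toV4.toPerm * genA)) * genA = genA * blocks L * y.toV4.toPerm * (genA * genA) by group, genA_sq', mul_one]
        rw [e]
        refine isOfFinOrder_of_conj (main_step n w IHn IHw (L ++ [y]) ?_ ?_)
        · simp [hlen] at hn; rw [List.length_append, List.length_singleton]; cases y <;> simp [BCD.toV4] at hn <;> omega
        · simpa [hwt, List.map_append, List.sum_append] using hw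

/-- **GRIGORCHUK'S TORSION THEOREM (for the tree's `𝔊`): every element of the first Grigorchuk group has finite order.**
[cite: Grigorchuk1980, Theorem: every element of the group has finite order] -/
theorem isOfFinOrder_of_mem {g : Equiv.Perm Ray} (hg : g ∈ grigorchukGroup) : IsOfFinOrder g := by
  obtain ⟨N, rfl⟩ := exists_nform_of_mem hg
  exact isOfFinOrder_eval N.len N.weight N le_rfl le_rfl

end Grigorchuk

end Summit.CriticalPhenomena.PercolationContinuityZ3.Theorems.Transplant

end
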